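import Summits.SmoothPoincare4.SmoothPoincare4.Theorems.SymplecticOrigamiOrigamiFoldExistenceHelperStableSeamHypothesesInhabited
import Summits.SmoothPoincare4.SmoothPoincare4.Theorems.SymplecticOrigamiOrigamiFoldExistenceHelperDarbouxBallSphereProdFour
import Summits.SmoothPoincare4.SmoothPoincare4.Theorems.SymplecticOrigamiOrigamiFoldExistenceHelperAntipodalChartPair
import Literature.Topology.FourManifolds.StereographicInversion
import Literature.Geometry.Symplectic.GromovR4RelEnd

/-!
# Helper `helper_roundSeamHypotheses_inhabited` of line `stable-seam-host` for crux
`OrigamiFoldExistence` (item stmt-SmoothPoincare4-7844, route route-SmoothPoincare4-SymplecticOrigami;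
lead c11, brick R0)

**NON-VACUITY of the hypothesis package of the round-seam rung** ("round-seam rung of STUB 3 ⇐
`GromovRecognitionRelEnd`") **at `S = S⁴`.**  The rung says: if the fake ball of a homotopy
`4`-sphere `S` (the complement of a chart ball `e : ℝ⁴ ↪ S`) sits, through an embedding `J` of a
neighbourhood, in a closed simply connected rational symplectic host `(X, Ω)`, and the seam germ is
ROUND in the chart `e` — on an annulus `1 - δ < ‖y‖ < 1 + δ`,
`Ω((J ∘ e) y)(d(J ∘ e)_y v, d(J ∘ e)_y w) = κ² · ω₀(A dι_y v, A dι_y w)` with `ω₀` the standard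
symplectic form of `ℝ⁴` (`Literature.Geometry.Symplectic.stdSymplecticForm`), `ι(y) = y/‖y‖²` the
inversion (`Literature.Geometry.Symplectic.inversion`), `A` a linear isometry of `ℝ⁴` and `κ > 0` —
then `S ≅ S⁴`.  This file certifies in the kernel, for the exact typed clauses, that this
hypothesis package is inhabited, by the genuine ball of `S⁴` in `(S² × S², σ ⊕ σ)`:

* `S = S⁴` (Mathlib's round sphere, oriented by the tree's
  `isOrientable_of_homotopyEquiv_sphere_four_holds`), `e = (chartAt q)⁻¹` its genuine chart ball;
* `(X, Ω) = (SphereProdFour, σ ⊕ σ)`, the `ℝ⁴`-charted `S² × S²` with its square-zero symplectic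
  sphere pair (`Literature.Geometry.Symplectic.sphereProdFour_hostPackage`) — the first disjunct of
  the host clause;
* `J = G ∘ π`, where `G : B⁴(2) → S² × S²` is the symplectic Darboux ball
  (`helper_darbouxBall_sphereProdFour`) and `π = ¼ • chartAt (-q)` the rescaled antipodal chart:
  `J` is `C^∞`, injective and immersive on an open `U ⊇ S⁴ ∖ e(B⁴)`;
* the ROUND clause with `κ = 1`, `A = L := stereoTransfer q`, `δ = ½`: on `ℝ⁴ ∖ {0}` the transition
  of Mathlib's stereographic atlas is `π ∘ e = L ∘ ι` (tree theorem `chartAt_sphere_neg_eq`), so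
  `d(π ∘ e)_y = L ∘ dι_y`, and for `½ < ‖y‖` the point `L (ι y)` (of norm `‖y‖⁻¹ < 2`) lies in the
  Darboux ball where `G^*(σ ⊕ σ) = ω₀`; the chain rule gives
  `Ω((J ∘ e) y)(d(J ∘ e) v, d(J ∘ e) w) = ω₀(L dι_y v, L dι_y w)`.

The chart-pair lemmas are adapted from the sibling file
`…HelperAntipodalChartPair.lean` (whose exported statement records the transition only ON the unit
sphere; here it is needed on an annulus), the fake-ball-neighbourhood embedding from
`…HelperStableSeamHypothesesInhabited.lean`.  No definitions, no named facts, no `sorry`.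

Sources: M. W. Hirsch, *Differential Topology* (1976), §1.1 (stereographic atlas, transition
`x ↦ x/‖x‖²`); D. McDuff, D. Salamon, *Introduction to Symplectic Topology*, 3rd ed. (2017), §3.1,
Ex. 3.1.2, Ex. 10.4.2 (iii); M. Gromov, *Pseudoholomorphic curves in symplectic manifolds*,
Invent. Math. 82 (1985), §0.3.C.
-/

noncomputable section

-- the prescribed namespace `Summit.<P>.<Sub>.…` duplicates `SmoothPoincare4` (P = Sub)
set_option linter.dupNamespace false

open scoped Manifold ContDiff Topology RealInnerProductSpace
open Set Function Metric
open Literature.Geometry.Symplectic Literature.Geometry.Kaehler Literature.Topology.FourManifolds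

namespace Summit.SmoothPoincare4.SmoothPoincare4.Theorems.OrigamiFoldExistence.StableSeamHost

/-! ### The antipodal chart pair of `S⁴` (adapted from `…HelperAntipodalChartPair.lean`) -/

section Pair

variable (q : Metric.sphere (0 : EuclideanSpace ℝ (Fin 5)) 1)
  {c : EuclideanSpace ℝ (Fin 4) →L[ℝ] EuclideanSpace ℝ (Fin 4)} (hc : ∀ y, c y = (4 : ℝ)⁻¹ • y)
  {π : Metric.sphere (0 : EuclideanSpace ℝ (Fin 5)) 1 → EuclideanSpace ℝ (Fin 4)}
  (hπ : ∀ x, π x = c (extChartAt (𝓡 4) (-q) x))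

/-- In the boundaryless model `𝓡 4` the extended chart at `-q` is the chart at `-q`. [folklore] -/
private theorem extChartAt_neg_apply (x : Metric.sphere (0 : EuclideanSpace ℝ (Fin 5)) 1) :
    extChartAt (𝓡 4) (-q) x = chartAt (EuclideanSpace ℝ (Fin 4)) (-q) x := by
  simp only [extChartAt_coe, Function.comp_apply, modelWithCornersSelf_coe, id_eq]

/-- **The inverse chart of `S⁴` at `q` is a smooth embedding `ℝ⁴ → S⁴`** (a chart of the maximal
atlas with target `univ`; tree lemma `isSmoothEmbedding_symm_of_target_eq_univ`). [folklore] -/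
private theorem isSmoothEmbedding_chartBall :
    Manifold.IsSmoothEmbedding (𝓡 4) (𝓡 4) ∞ (chartAt (EuclideanSpace ℝ (Fin 4)) q).symm := by
  -- adapted from `…HelperAntipodalChartPair.lean`
  haveI : Fact (Module.finrank ℝ (EuclideanSpace ℝ (Fin 5)) = 4 + 1) := ⟨finrank_euclideanSpace_fin⟩
  exact isSmoothEmbedding_symm_of_target_eq_univ
    (IsManifold.chart_mem_maximalAtlas (I := 𝓡 4) (n := ∞) q) (chartAt_sphere_target q)

/-- `e w` lies in the chart domain `{-q}ᶜ` and `chartAt q (e w) = w`. [folklore] -/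
private theorem chartBall_mem_source (w : EuclideanSpace ℝ (Fin 4)) :
    (chartAt (EuclideanSpace ℝ (Fin 4)) q).symm w ∈ (chartAt (EuclideanSpace ℝ (Fin 4)) q).source ∧
      chartAt (EuclideanSpace ℝ (Fin 4)) q ((chartAt (EuclideanSpace ℝ (Fin 4)) q).symm w) = w := by
  -- adapted from `…HelperAntipodalChartPair.lean`
  haveI : Fact (Module.finrank ℝ (EuclideanSpace ℝ (Fin 5)) = 4 + 1) := ⟨finrank_euclideanSpace_fin⟩
  have hw : w ∈ (chartAt (EuclideanSpace ℝ (Fin 4)) q).target := by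
    rw [chartAt_sphere_target]; exact mem_univ w
  exact ⟨(chartAt _ q).map_target hw, (chartAt _ q).right_inv hw⟩

/-- `e w ≠ q` and `e w ≠ -q` for `w ≠ 0`. [folklore] -/
private theorem chartBall_ne_poles {w : EuclideanSpace ℝ (Fin 4)} (hw : w ≠ 0) :
    (chartAt (EuclideanSpace ℝ (Fin 4)) q).symm w ≠ q ∧
      (chartAt (EuclideanSpace ℝ (Fin 4)) q).symm w ≠ -q := by
  -- adapted from `…HelperAntipodalChartPair.lean`
  haveI : Fact (Module.finrank ℝ (EuclideanSpace ℝ (Fin 5)) = 4 + 1) := ⟨finrank_euclideanSpace_fin⟩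
  obtain ⟨hmem, hright⟩ := chartBall_mem_source q w
  refine ⟨fun h => hw ?_, fun h => ?_⟩
  · rw [← hright, h, chartAt_sphere_apply_self]
  · rw [chartAt_sphere_source] at hmem
    exact hmem h

include hc in
/-- The rescaling `c = ¼ • id` is bijective. [folklore] -/
private theorem bijective_quarter : Bijective c := by
  -- adapted from `…HelperAntipodalChartPair.lean`
  refine ⟨(injective_iff_map_eq_zero _).2 fun y hy => ?_, fun y => ⟨(4 : ℝ) • y, ?_⟩⟩
  · rw [hc] at hy
    simpa using hy
  · rw [hc, smul_smul]; norm_num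

include hπ in
/-- `π` is `C^∞` on the chart domain of `-q`. [folklore] -/
private theorem contMDiffOn_antipodalChart :
    ContMDiffOn (𝓡 4) (𝓡 4) ∞ π (chartAt (EuclideanSpace ℝ (Fin 4)) (-q)).source := by
  -- adapted from `…HelperAntipodalChartPair.lean`
  rw [show π = fun x => c (extChartAt (𝓡 4) (-q) x) from funext hπ]
  exact c.contMDiff.comp_contMDiffOn contMDiffOn_extChartAt

include hc hπ in
/-- `π` is injective on the chart domain of `-q`. [folklore] -/
private theorem injOn_antipodalChart : InjOn π (chartAt (EuclideanSpace ℝ (Fin 4)) (-q)).source := by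
  -- adapted from `…HelperAntipodalChartPair.lean`
  intro x hx y hy h
  rw [hπ, hπ] at h
  have h' := (bijective_quarter hc).1 h
  rw [← extChartAt_source (𝓡 4)] at hx hy
  exact (extChartAt (𝓡 4) (-q)).injOn hx hy h'

include hc hπ in
/-- `π` has bijective differential on the chart domain of `-q`. [folklore] -/
private theorem bijective_mfderiv_antipodalChart {x : Metric.sphere (0 : EuclideanSpace ℝ (Fin 5)) 1}
    (hx : x ∈ (chartAt (EuclideanSpace ℝ (Fin 4)) (-q)).source) :
    Bijective (mfderiv (𝓡 4) (𝓡 4) π x) := by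
  -- adapted from `…HelperAntipodalChartPair.lean`
  have hx' : x ∈ (extChartAt (𝓡 4) (-q)).source := by rwa [extChartAt_source]
  have hd : HasMFDerivAt (𝓡 4) (𝓡 4) (extChartAt (𝓡 4) (-q)) x
      (mfderiv (𝓡 4) (𝓡 4) (extChartAt (𝓡 4) (-q)) x) :=
    ((contMDiffOn_extChartAt (n := ∞)).contMDiffAt ((chartAt _ (-q)).open_source.mem_nhds hx)
      |>.mdifferentiableAt (by simp)).hasMFDerivAt
  have hπ' : π = fun x => c (extChartAt (𝓡 4) (-q) x) := funext hπ
  subst hπ'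
  have hcomp : HasMFDerivAt (𝓡 4) (𝓡 4) (fun x => c (extChartAt (𝓡 4) (-q) x)) x
      (c.comp (mfderiv (𝓡 4) (𝓡 4) (extChartAt (𝓡 4) (-q)) x)) :=
    (c.hasMFDerivAt (x := extChartAt (𝓡 4) (-q) x)).comp x hd
  rw [hcomp.mfderiv]
  exact (bijective_quarter hc).comp (Literature.Geometry.Manifold.bijective_mfderiv_extChartAt hx')

include hπ in
/-- `π (-q) = 0`. [folklore] -/
private theorem antipodalChart_neg : π (-q) = 0 := by
  -- adapted from `…HelperAntipodalChartPair.lean`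
  haveI : Fact (Module.finrank ℝ (EuclideanSpace ℝ (Fin 5)) = 4 + 1) := ⟨finrank_euclideanSpace_fin⟩
  rw [hπ, extChartAt_neg_apply, chartAt_sphere_apply_self, map_zero]

include hπ in
/-- `U = {x ≠ q | ‖π x‖ < 3/2}` is open. [folklore] -/
private theorem isOpen_fakeBallNhd :
    IsOpen ((chartAt (EuclideanSpace ℝ (Fin 4)) (-q)).source ∩ π ⁻¹' ball 0 (3 / 2)) :=
  -- adapted from `…HelperAntipodalChartPair.lean`
  (contMDiffOn_antipodalChart q hπ).continuousOn.isOpen_inter_preimage (chartAt _ (-q)).open_source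
    isOpen_ball

section Transfer

variable [Fact (Module.finrank ℝ (EuclideanSpace ℝ (Fin 5)) = 4 + 1)]

include hc hπ in
/-- **The transition `π ∘ e = L ∘ ι` on `ℝ⁴ ∖ {0}`**: `π (e w) = L (ι w)` for `w ≠ 0`, with
`L = stereoTransfer q` a linear isometry and `ι` the inversion (tree `chartAt_sphere_neg_eq`:
antipodal charts of Mathlib's sphere differ by `4 • L ∘ ι`). [folklore] -/
private theorem antipodalChart_chartBall {w : EuclideanSpace ℝ (Fin 4)} (hw : w ≠ 0) :
    π ((chartAt (EuclideanSpace ℝ (Fin 4)) q).symm w) =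
      stereoTransfer (n := 4) q (Literature.Geometry.Symplectic.inversion w) := by
  -- adapted from `…HelperAntipodalChartPair.lean` (`pi_eq_transfer`, `pi_chartAt_symm`)
  obtain ⟨h1, h2⟩ := chartBall_ne_poles q hw
  rw [hπ, extChartAt_neg_apply, chartAt_sphere_neg_eq q _ h1 h2, map_smul, hc, smul_smul,
    (chartBall_mem_source q w).2]
  norm_num
  rfl

include hc hπ in
/-- **The fake ball lies in `U`**: a point outside `e(B⁴)` is `-q` (where `π = 0`) or `e w` with
`‖w‖ ≥ 1`, where `‖π (e w)‖ = ‖w‖⁻¹ ≤ 1`. [folklore] -/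
private theorem fakeBall_subset_fakeBallNhd :
    ((chartAt (EuclideanSpace ℝ (Fin 4)) q).symm '' ball (0 : EuclideanSpace ℝ (Fin 4)) 1)ᶜ ⊆
      (chartAt (EuclideanSpace ℝ (Fin 4)) (-q)).source ∩ π ⁻¹' ball 0 (3 / 2) := by
  -- adapted from `…HelperAntipodalChartPair.lean`
  intro x hx
  by_cases hxq : x = -q
  · subst hxq
    refine ⟨mem_chart_source _ _, ?_⟩
    rw [mem_preimage, antipodalChart_neg q hπ]
    exact mem_ball_self (by norm_num)
  · -- `x = e w` with `w = chartAt q x`, `‖w‖ ≥ 1`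
    have hxs : x ∈ (chartAt (EuclideanSpace ℝ (Fin 4)) q).source := by
      rw [chartAt_sphere_source]; exact hxq
    set w := chartAt (EuclideanSpace ℝ (Fin 4)) q x with hw
    have hex : (chartAt (EuclideanSpace ℝ (Fin 4)) q).symm w = x := (chartAt _ q).left_inv hxs
    have hw1 : 1 ≤ ‖w‖ := by
      by_contra h
      exact hx ⟨w, mem_ball_zero_iff.2 (not_le.1 h), hex⟩
    have hw0 : w ≠ 0 := by
      intro h0; rw [h0, norm_zero] at hw1; exact absurd hw1 (by norm_num)
    obtain ⟨h1, h2⟩ := chartBall_ne_poles q hw0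
    rw [hex] at h1 h2
    refine ⟨?_, ?_⟩
    · rw [chartAt_sphere_source, neg_neg]; exact h1
    · rw [mem_preimage, ← hex, antipodalChart_chartBall q hc hπ hw0, mem_ball_zero_iff,
        LinearIsometryEquiv.norm_map, norm_inversion]
      calc ‖w‖⁻¹ ≤ 1 := inv_le_one_of_one_le₀ hw1
        _ < 3 / 2 := by norm_num

include hc hπ in
/-- **The differential of the transition on `ℝ⁴ ∖ {0}`**: near `y ≠ 0`, `π ∘ e = L ∘ ι`, so
`d(π ∘ e)_y = L ∘ dι_y` (honest Fréchet derivative of `ι` at `y ≠ 0`). [folklore] -/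
private theorem hasMFDerivAt_antipodalChart_chartBall {y : EuclideanSpace ℝ (Fin 4)} (hy : y ≠ 0) :
    HasMFDerivAt (𝓡 4) (𝓡 4) (π ∘ (chartAt (EuclideanSpace ℝ (Fin 4)) q).symm) y
      ((stereoTransfer (n := 4) q).toContinuousLinearEquiv.toContinuousLinearMap.comp
        (fderiv ℝ Literature.Geometry.Symplectic.inversion y)) := by
  have hι : HasFDerivAt Literature.Geometry.Symplectic.inversion
      (fderiv ℝ Literature.Geometry.Symplectic.inversion y) y :=
    (differentiableAt_inversion hy).hasFDerivAt
  have hL := ((stereoTransfer (n := 4) q).toContinuousLinearEquiv.hasFDerivAt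
    (x := Literature.Geometry.Symplectic.inversion y)).comp y hι
  have hmf := hasMFDerivAt_iff_hasFDerivAt.2 hL
  refine hmf.congr_of_eventuallyEq ?_
  filter_upwards [isOpen_compl_singleton.mem_nhds hy] with w hw
  exact antipodalChart_chartBall q hc hπ hw

end Transfer

end Pair

/-- **The genuine ball of `S⁴` and the chart around its complement, with the annulus-level
transition.**  A smooth embedding `e : ℝ⁴ → S⁴` of the whole model space, an open `U ⊇ S⁴ ∖ e(B⁴)`
and a map `π : S⁴ → ℝ⁴`, `C^∞`, injective and with bijective differential on `U`, `π(U) ⊆ B⁴(2)`,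
whose transition with `e` on `ℝ⁴ ∖ {0}` is `L ∘ ι` for a linear isometry `L` of `ℝ⁴`:
`π (e y) = L (ι y)` and `d(π ∘ e)_y = L ∘ dι_y` (Hirsch 1976, §1.1). [folklore] -/
private theorem antipodalChartPair_round :
    ∃ (e : EuclideanSpace ℝ (Fin 4) → Metric.sphere (0 : EuclideanSpace ℝ (Fin 5)) 1)
      (π : Metric.sphere (0 : EuclideanSpace ℝ (Fin 5)) 1 → EuclideanSpace ℝ (Fin 4))
      (U : Set (Metric.sphere (0 : EuclideanSpace ℝ (Fin 5)) 1))
      (L : EuclideanSpace ℝ (Fin 4) ≃ₗᵢ[ℝ] EuclideanSpace ℝ (Fin 4)),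
      Manifold.IsSmoothEmbedding (𝓡 4) (𝓡 4) ∞ e ∧ IsOpen U ∧
      (e '' Metric.ball (0 : EuclideanSpace ℝ (Fin 4)) 1)ᶜ ⊆ U ∧ ContMDiffOn (𝓡 4) (𝓡 4) ∞ π U ∧
      Set.InjOn π U ∧ (∀ x ∈ U, Function.Bijective (mfderiv (𝓡 4) (𝓡 4) π x)) ∧
      Set.MapsTo π U (Metric.ball (0 : EuclideanSpace ℝ (Fin 4)) 2) ∧
      ∀ y : EuclideanSpace ℝ (Fin 4), y ≠ 0 →
        π (e y) = L (Literature.Geometry.Symplectic.inversion y) ∧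
        HasMFDerivAt (𝓡 4) (𝓡 4) (π ∘ e) y
          (L.toContinuousLinearEquiv.toContinuousLinearMap.comp
            (fderiv ℝ Literature.Geometry.Symplectic.inversion y)) := by
  haveI : Fact (Module.finrank ℝ (EuclideanSpace ℝ (Fin 5)) = 4 + 1) := ⟨finrank_euclideanSpace_fin⟩
  set q : Metric.sphere (0 : EuclideanSpace ℝ (Fin 5)) 1 := ⟨EuclideanSpace.single 0 1, by simp⟩
  obtain ⟨c, hc⟩ : ∃ c : EuclideanSpace ℝ (Fin 4) →L[ℝ] EuclideanSpace ℝ (Fin 4), ∀ y,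
      c y = (4 : ℝ)⁻¹ • y := ⟨(4 : ℝ)⁻¹ • ContinuousLinearMap.id ℝ _, fun y => rfl⟩
  obtain ⟨π, hπ⟩ : ∃ π : Metric.sphere (0 : EuclideanSpace ℝ (Fin 5)) 1 → EuclideanSpace ℝ (Fin 4),
      ∀ x, π x = c (extChartAt (𝓡 4) (-q) x) := ⟨_, fun x => rfl⟩
  refine ⟨(chartAt (EuclideanSpace ℝ (Fin 4)) q).symm, π,
    (chartAt (EuclideanSpace ℝ (Fin 4)) (-q)).source ∩ π ⁻¹' ball 0 (3 / 2), stereoTransfer (n := 4) q,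
    isSmoothEmbedding_chartBall q, isOpen_fakeBallNhd q hπ, fakeBall_subset_fakeBallNhd q hc hπ,
    (contMDiffOn_antipodalChart q hπ).mono inter_subset_left,
    (injOn_antipodalChart q hc hπ).mono inter_subset_left,
    fun x hx => bijective_mfderiv_antipodalChart q hc hπ hx.1, fun x hx => ?_, fun y hy => ?_⟩
  · exact ball_subset_ball (by norm_num) hx.2
  · exact ⟨antipodalChart_chartBall q hc hπ hy, hasMFDerivAt_antipodalChart_chartBall q hc hπ hy⟩

/-! ### The witness `J = G ∘ π` -/

/-- A point of the round 2-sphere and its antipode differ. [folklore] -/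
private theorem northPole_ne_antipode :
    (⟨EuclideanSpace.single 0 1, by simp⟩ : Metric.sphere (0 : EuclideanSpace ℝ (Fin 3)) 1) ≠
      -⟨EuclideanSpace.single 0 1, by simp⟩ :=
  ne_neg_of_mem_unit_sphere ℝ _

section Witness

variable {e : EuclideanSpace ℝ (Fin 4) → Metric.sphere (0 : EuclideanSpace ℝ (Fin 5)) 1}
  {π : Metric.sphere (0 : EuclideanSpace ℝ (Fin 5)) 1 → EuclideanSpace ℝ (Fin 4)}
  {U : Set (Metric.sphere (0 : EuclideanSpace ℝ (Fin 5)) 1)}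
  {L : EuclideanSpace ℝ (Fin 4) ≃ₗᵢ[ℝ] EuclideanSpace ℝ (Fin 4)}
  {G : EuclideanSpace ℝ (Fin 4) → SphereProdFour}
  (hU : IsOpen U) (hDU : (e '' ball (0 : EuclideanSpace ℝ (Fin 4)) 1)ᶜ ⊆ U)
  (hπs : ContMDiffOn (𝓡 4) (𝓡 4) ∞ π U) (hπi : InjOn π U)
  (hπd : ∀ x ∈ U, Bijective (mfderiv (𝓡 4) (𝓡 4) π x))
  (hπU : MapsTo π U (ball (0 : EuclideanSpace ℝ (Fin 4)) 2))
  (hseam : ∀ y : EuclideanSpace ℝ (Fin 4), y ≠ 0 →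
    π (e y) = L (Literature.Geometry.Symplectic.inversion y) ∧
    HasMFDerivAt (𝓡 4) (𝓡 4) (π ∘ e) y
      (L.toContinuousLinearEquiv.toContinuousLinearMap.comp
        (fderiv ℝ Literature.Geometry.Symplectic.inversion y)))
  (hGs : ContMDiffOn (𝓡 4) (𝓡 4) ∞ G (ball 0 2)) (hGi : InjOn G (ball 0 2))
  (hGd : ∀ z ∈ ball (0 : EuclideanSpace ℝ (Fin 4)) 2, Bijective (mfderiv (𝓡 4) (𝓡 4) G z))
  (hGσ : ∀ z ∈ ball (0 : EuclideanSpace ℝ (Fin 4)) 2, ∀ a b : EuclideanSpace ℝ (Fin 4),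
    sphereProdFourForm (G z) ![mfderiv (𝓡 4) (𝓡 4) G z a, mfderiv (𝓡 4) (𝓡 4) G z b] =
      stdSymplecticForm a b)

include hU hDU hπs hπi hπd hπU hGs hGi hGd in
/-- **`J = G ∘ π` embeds a neighbourhood of the fake ball** `S⁴ ∖ e(B⁴)`: on `U` it is `C^∞`,
injective and has bijective differential (chain rule). [folklore] -/
private theorem embedsFakeBallNhd_roundWitness :
    ∃ U : Set (Metric.sphere (0 : EuclideanSpace ℝ (Fin 5)) 1), IsOpen U ∧
      (e '' Metric.ball (0 : EuclideanSpace ℝ (Fin 4)) 1)ᶜ ⊆ U ∧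
      ContMDiffOn (𝓡 4) (𝓡 4) ∞ (fun x => G (π x)) U ∧ Set.InjOn (fun x => G (π x)) U ∧
      ∀ x ∈ U, Function.Bijective (mfderiv (𝓡 4) (𝓡 4) (fun x => G (π x)) x) := by
  -- adapted from `…HelperStableSeamHypothesesInhabited.lean`
  refine ⟨U, hU, hDU, hGs.comp hπs hπU, hGi.comp hπi hπU, fun x hx => ?_⟩
  have hπx : MDifferentiableAt (𝓡 4) (𝓡 4) π x :=
    (hπs.contMDiffAt (hU.mem_nhds hx)).mdifferentiableAt (by simp)
  have hGx : MDifferentiableAt (𝓡 4) (𝓡 4) G (π x) :=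
    (hGs.contMDiffAt (isOpen_ball.mem_nhds (hπU hx))).mdifferentiableAt (by simp)
  have hcomp : mfderiv (𝓡 4) (𝓡 4) (fun x => G (π x)) x =
      (mfderiv (𝓡 4) (𝓡 4) G (π x)).comp (mfderiv (𝓡 4) (𝓡 4) π x) := mfderiv_comp x hGx hπx
  rw [hcomp]
  exact (hGd _ (hπU hx)).comp (hπd x hx)

include hseam hGs hGσ in
/-- **The seam germ of the witness is ROUND**: for `½ < ‖y‖` (so that `‖L (ι y)‖ = ‖y‖⁻¹ < 2`
lies in the Darboux ball), `Ω((J ∘ e) y)(d(J ∘ e) v, d(J ∘ e) w) = (G^*Ω)_{L ι y}(L dι_y v, L dι_y w)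
= ω₀(L dι_y v, L dι_y w)` by the chain rule and `G^*(σ ⊕ σ) = ω₀`. [folklore] -/
private theorem roundClause_witness {y : EuclideanSpace ℝ (Fin 4)} (hy : 1 - 2⁻¹ < ‖y‖)
    (v w : EuclideanSpace ℝ (Fin 4)) :
    sphereProdFourForm (((fun x => G (π x)) ∘ e) y)
      ![mfderiv (𝓡 4) (𝓡 4) ((fun x => G (π x)) ∘ e) y v,
        mfderiv (𝓡 4) (𝓡 4) ((fun x => G (π x)) ∘ e) y w] =
      stdSymplecticForm (L (fderiv ℝ Literature.Geometry.Symplectic.inversion y v))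
        (L (fderiv ℝ Literature.Geometry.Symplectic.inversion y w)) := by
  have hy' : 2⁻¹ < ‖y‖ := by convert hy using 1; norm_num
  have hy0 : y ≠ 0 := by
    intro h; rw [h, norm_zero] at hy'; norm_num at hy'
  obtain ⟨hpt, hd⟩ := hseam y hy0
  have hmem : L (Literature.Geometry.Symplectic.inversion y) ∈
      ball (0 : EuclideanSpace ℝ (Fin 4)) 2 := by
    rw [mem_ball_zero_iff, L.norm_map, norm_inversion, inv_lt_comm₀ (norm_pos_iff.2 hy0) two_pos]
    exact hy'
  have hGd' : MDifferentiableAt (𝓡 4) (𝓡 4) G ((π ∘ e) y) := by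
    rw [Function.comp_apply, hpt]
    exact (hGs.contMDiffAt (isOpen_ball.mem_nhds hmem)).mdifferentiableAt (by simp)
  have hcomp : mfderiv (𝓡 4) (𝓡 4) ((fun x => G (π x)) ∘ e) y =
      (mfderiv (𝓡 4) (𝓡 4) G ((π ∘ e) y)).comp (mfderiv (𝓡 4) (𝓡 4) (π ∘ e) y) :=
    mfderiv_comp y hGd' hd.mdifferentiableAt
  rw [hcomp, hd.mfderiv]
  show sphereProdFourForm (G (π (e y)))
    ![mfderiv (𝓡 4) (𝓡 4) G (π (e y)) (L (fderiv ℝ Literature.Geometry.Symplectic.inversion y v)),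
      mfderiv (𝓡 4) (𝓡 4) G (π (e y))
        (L (fderiv ℝ Literature.Geometry.Symplectic.inversion y w))] = _
  rw [hpt]
  exact hGσ _ hmem _ _

end Witness

/-! ### The registered helper -/

/-- **The hypothesis package of the round-seam rung is inhabited at `S = S⁴`** (non-vacuity
certificate): take `S = S⁴` with its genuine chart ball `e = (chartAt q)⁻¹`, the host
`(X, Ω) = (S² × S², σ ⊕ σ)` charted on `ℝ⁴` with its square-zero symplectic sphere pair
(`sphereProdFour_hostPackage`), and `J = G ∘ π` — the symplectic Darboux ball
`G : B⁴(2) → S² × S²` composed with the rescaled antipodal chart `π = ¼ • chartAt (-q)`; then `J`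
embeds a neighbourhood of the fake ball `S⁴ ∖ e(B⁴)`, and since the transition of the stereographic
atlas is `π ∘ e = L ∘ ι` on `ℝ⁴ ∖ {0}` (`L` a linear isometry, `ι` the inversion) and `G` is
symplectic, the seam germ is ROUND with `κ = 1`, `A = L`, `δ = ½`:
`Ω((J ∘ e) y)(d(J ∘ e) v, d(J ∘ e) w) = ω₀(L dι_y v, L dι_y w)` for `½ < ‖y‖ < 3/2`. [folklore] -/
theorem helper_roundSeamHypotheses_inhabited : ∃ (S : Literature.Topology.FourManifolds.HomotopySphere 4) (e : EuclideanSpace ℝ (Fin 4) → S.carrier) (X : Type) (_ : TopologicalSpace X) (_ : T2Space X) (_ : SecondCountableTopology X) (_ : CompactSpace X) (_ : ChartedSpace (EuclideanSpace ℝ (Fin 4)) X) (_ : IsManifold (𝓡 4) ∞ X) (_ : SimplyConnectedSpace X) (Ω : Literature.Geometry.Kaehler.MForm (𝓡 4) X ℝ 2) (J : S.carrier → X) (κ : ℝ) (A : EuclideanSpace ℝ (Fin 4) ≃ₗᵢ[ℝ] EuclideanSpace ℝ (Fin 4)) (δ : ℝ), Nonempty (S.carrier ≃ₘ⟮𝓡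 4, 𝓡 4⟯ Metric.sphere (0 : EuclideanSpace ℝ (Fin 5)) 1) ∧ Manifold.IsSmoothEmbedding (𝓡 4) (𝓡 4) ∞ e ∧ (Literature.Geometry.Kaehler.IsSmoothForm Ω ∧ Literature.Geometry.Kaehler.IsClosedForm Ω ∧ ∀ x (v : TangentSpace (𝓡 4) x), v ≠ 0 → ∃ w, Ω x ![v, w] ≠ 0) ∧ (∃ U : Set S.carrier, IsOpen U ∧ (e '' Metric.ball (0 : EuclideanSpace ℝ (Fin 4)) 1)ᶜ ⊆ U ∧ ContMDiffOn (𝓡 4) (𝓡 4) ∞ J U ∧ Set.InjOn J U ∧ ∀ x ∈ U, Function.Bijective (mfderiv (𝓡 4) (𝓡 4) J x)) ∧ ((∃ c c' : (Metric.sphere (0 : EuclideanSpace ℝ (Fin 3)) 1) → X, (Manifold.IsSmoothEmbedding (𝓡 2) (𝓡 4) ∞ c ∧ (∀ y (v : TangentSpace (𝓡 2) y), v ≠ 0 → ∃ w : TangentSpace (𝓡 2) y, Ω (c y) ![mfderiv (𝓡 2) (𝓡 4) c y v, mfderiv (𝓡 2) (𝓡 4) c y w] ≠ 0) ∧ Manifold.IsSmoothEmbedding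 (𝓡 2) (𝓡 4) ∞ c' ∧ Disjoint (Set.range c) (Set.range c') ∧ ∃ H : unitInterval × (Metric.sphere (0 : EuclideanSpace ℝ (Fin 3)) 1) → X, Continuous H ∧ ∀ y, H (0, y) = c y ∧ H (1, y) = c' y)) ∨ (∃ (Ψ : X ≃ₘ⟮𝓡 4, 𝓡 4⟯ Literature.Topology.FourManifolds.ComplexProjectivePlane) (a : ℝ), 0 < a ∧ ∀ x (v w : TangentSpace (𝓡 4) x), Ω x ![v, w] = a * Literature.Geometry.Kaehler.CPn.fsForm 2 (Ψ x) ![mfderiv (𝓡 4) (𝓡 4) Ψ x v, mfderiv (𝓡 4) (𝓡 4) Ψ x w])) ∧ 0 < κ ∧ 0 < δ ∧ ∀ y : EuclideanSpace ℝ (Fin 4), 1 - δ < ‖y‖ → ‖y‖ < 1 + δ → ∀ v w : EuclideanSpace ℝ (Fin 4), Ω ((J ∘ e) y) ![mfderiv (𝓡 4) (𝓡 4) (J ∘ e) y v, mfderiv (𝓡 4) (𝓡 4) (J ∘ e) y w] = κ ^ 2 * Literature.Geometry.Symplectic.stdSymplecticForm (A (fderiv ℝ Literature.Geometry.Symplectic.inversion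 y v)) (A (fderiv ℝ Literature.Geometry.Symplectic.inversion y w)) := by
  obtain ⟨o⟩ := isOrientable_of_homotopyEquiv_sphere_four_holds
    (Metric.sphere (0 : EuclideanSpace ℝ (Fin 5)) 1) (ContinuousMap.HomotopyEquiv.refl _)
  obtain ⟨e, π, U, L, he, hU, hDU, hπs, hπi, hπd, hπU, hseam⟩ := antipodalChartPair_round
  obtain ⟨G, hGs, hGi, hGd, hGσ⟩ := helper_darbouxBall_sphereProdFour
  haveI : Fact (Module.finrank ℝ (EuclideanSpace ℝ (Fin 3)) = 2 + 1) := ⟨finrank_euclideanSpace_fin⟩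
  have hpkg := sphereProdFour_hostPackage northPole_ne_antipode
  refine ⟨⟨Metric.sphere (0 : EuclideanSpace ℝ (Fin 5)) 1, o, ⟨.refl _⟩⟩, e, SphereProdFour,
    inferInstance, inferInstance, inferInstance, inferInstance, inferInstance, inferInstance,
    inferInstance, sphereProdFourForm, fun x => G (π x), 1, L, 2⁻¹, ⟨Diffeomorph.refl _ _ _⟩, he,
    hpkg.1, embedsFakeBallNhd_roundWitness hU hDU hπs hπi hπd hπU hGs hGi hGd, Or.inl ⟨_, _, hpkg.2⟩,
    one_pos, by norm_num, fun y hy _ v w => ?_⟩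
  rw [one_pow, one_mul]
  exact roundClause_witness hseam hGs hGσ hy v w

end Summit.SmoothPoincare4.SmoothPoincare4.Theorems.OrigamiFoldExistence.StableSeamHost

end
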